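import Summits.AnomalousDissipation.AnomalousDissipation.Theses.MarginalStabilityChain
import Literature.Analysis.FluidPDE.StretchedLayerNS

/-!
# Disproof of `StrainedLayerLaw` — findings (refuter-cdisprove, standing adversary; cycle 1, rev 2026-08-16)

Crux `stmt-AnomalousDissipation-3007` = `MarginalStabilityChain.StrainedLayerLaw` (the "hydrodynamic
plasmoid law": ∃ c > 0 ∀ L > 0 ∃ ν₀ > 0 ∃ ONE admissible perturbation θ ∀ ν ∈ (0, ν₀] ∀ global classical
solutions of the stretched 2-D Navier–Stokes system from `U_B^ν + θ`: liminf-mean dissipation ≥ c·min(L,1)).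

STATUS: NOT REFUTED (resists).  WHY IT RESISTS A CHEAP KILL: the negation is
`∀ c ∃ L ∀ ν₀ ∀ θ ∃ ν ∃ (u,v,p) solution ∧ small dissipation`; since θ is the PROVER's choice, any
refutation must produce a GLOBAL CLASSICAL SOLUTION of the stretched system from `U_B + θ` for an
arbitrary admissible θ (a global well-posedness theorem in this unbounded-drift class, not in the tree)
AND show it relaminarises — the open physical question itself.  Formal junk (ENNReal `⊤` slices, `deriv`
off differentiability, `T ≤ 0`) all sit on the harmless side of the inequality.

CONTENTS (all `theorem`s below are sorry-free unless marked NEAR-MISS):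
* §1 `AdmissibleTheta`, `LawAt`, `strainedLayerLaw_iff` — verbatim decomposition of the crux
  (provers may `rw [strainedLayerLaw_iff]`).
* §2 LOAD-BEARING `∃ θ`: `lawAt_zero_false` — with θ = 0 the Burgers layer `U_B^ν` itself is a global
  classical solution in the crux's class (non-vacuity of the hypothesis list, in the crux's OWN inlined
  normalisation) and its liminf-mean dissipation is the laminar Sweet–Parker rung `(ν/4π)^{1/2}`, which is
  `< c·min(L,1)` once `ν < 4π (c·min(L,1))²`; hence `not_strainedLayerLaw_forall_theta`: the natural
  strengthening "for EVERY admissible θ" is FALSE, and any proof must use its θ non-trivially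
  (x-dependence is necessary: §4).
* §3 SYMMETRY / hypothesis-mutation remarks (docstrings): decaying `y`-translation `y ↦ y − h₀e^{−t}`
  maps solutions to solutions with the SAME dissipation; Galilean `x`-drift is excluded by the `u`
  far field alone (so `p`-periodicity is possibly redundant); `v → 0` excludes `p ∼ b(t) y`.
* §4 REDUCTION (sorry-free): `ParallelRelaxes` + `lawAt_parallel_false_of_relaxation` — an
  x-independent θ cannot carry the law once the 1-D strained heat flow from `U_B + θ₁` relaxes; so
  the prover's θ must depend on x. §4b DISCHARGE (sorry-free): the BREATHING BURGERS LAYER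
  `U_B^{s(t)}`, `s(t) = ν + (μ − ν)e^{−2t}`, is an explicit UNSTEADY exact member of the class
  (`breathing_pde`, `contDiff_breathing`), proving `parallelRelaxes_thickLayer` and
  `lawAt_thickLayer_false`: a FIXED ν-independent layer datum `U_B^μ` (θ = (U_B^μ − U_B^ν, 0),
  Gaussian-tailed) relaminarises below the Sweet–Parker rung. Uniqueness in the pointwise-far-field
  class (M3) is not asserted by the crux — no ghost found (see §7 `UniqueInClass`).
* §5 NUMERICS (kit jobs, see docstring of `numerics_log`): 2-D pseudo-spectral DNS of the stretched
  system from `U_B + θ` at ν = 1e-2 … 1e-4 — the route's CHEAPEST FALSIFIER; results recorded there.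
* §6 LITERATURE (Kerr 2024 §3 formalised: in the SHEAR-FREE `ΔU = 0` problem steady decaying modes need
  fed tails; explicitly NOT transferable to the sheared layer — scope note there; GM2016 λ = 1 endpoint).
* §7 PRE-PICK AUDIT of the round-1 crux ideas (A sum rule, B contraction-capture, C cell attractor):
  identities A1/A3/B2/B3 hand-verified TRUE; `UniqueInClass` flagged as the weak joint every transfer
  leans on (doubtful as stated, unrefuted); C1 open; seeded-cell falsifier queued [compute j013477].
-/

noncomputable section

set_option linter.dupNamespace false

open Set Function Filter Topology MeasureTheory intervalIntegral
open scoped ENNReal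

namespace Summit.AnomalousDissipation.AnomalousDissipation.Cruxes.StrainedLayerLaw.Disproof

open Summit.AnomalousDissipation.AnomalousDissipation.Theses.MarginalStabilityChain
open Literature.Analysis.FluidPDE

/-! ## §1 Verbatim decomposition of the crux -/

/-- The five admissibility clauses on the perturbation `θ = (θ₁, θ₂)` of the crux, verbatim:
`C²`, `L`-periodic in `x`, vanishing for `|y| ≥ R`, divergence-free. -/
def AdmissibleTheta (L : ℝ) (θ₁ θ₂ : ℝ → ℝ → ℝ) : Prop :=
  ContDiff ℝ 2 (fun q : ℝ × ℝ => θ₁ q.1 q.2) ∧ ContDiff ℝ 2 (fun q : ℝ × ℝ => θ₂ q.1 q.2) ∧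
    (∀ x y, θ₁ (x + L) y = θ₁ x y ∧ θ₂ (x + L) y = θ₂ x y) ∧
    (∃ R : ℝ, ∀ x y, R ≤ |y| → θ₁ x y = 0 ∧ θ₂ x y = 0) ∧
    (∀ x y, deriv (fun s => θ₁ s y) x + deriv (fun s => θ₂ x s) y = 0)

/-- The law at fixed `(c, L, ν, θ)`, verbatim from the crux: every global classical solution
`(u, v, p)` of the stretched 2-D Navier–Stokes system (γ = ΔU = 1) from `U_B^ν + θ` has
`ofReal (c·min L 1) ≤ liminf_T ofReal T⁻¹ · ∫⁻_{(0,T]} D`. -/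
def LawAt (c L ν : ℝ) (θ₁ θ₂ : ℝ → ℝ → ℝ) : Prop :=
  ∀ u v p : ℝ → ℝ → ℝ → ℝ, let Dt : (ℝ → ℝ → ℝ → ℝ) → ℝ → ℝ → ℝ → ℝ := fun f t x y => deriv (fun s => f s x y) t; let Dx : (ℝ → ℝ → ℝ → ℝ) → ℝ → ℝ → ℝ → ℝ := fun f t x y => deriv (fun s => f t s y) x; let Dy : (ℝ → ℝ → ℝ → ℝ) → ℝ → ℝ → ℝ → ℝ := fun f t x y => deriv (fun s => f t x s) y; let UB : ℝ → ℝ := fun y => (Real.sqrt (2 * Real.pi * ν))⁻¹ * ∫ s in (0:ℝ)..y, Real.exp (-(s ^ 2) / (2 * ν)); let D : ℝ → ENNReal := fun t => ENNReal.ofReal (ν / L) * ∫⁻ x in Set.Ioc 0 L, ∫⁻ y, ENNReal.ofReal (Dx u t x y ^ 2 + Dy u t x y ^ 2 + Dx v t x y ^ 2 + Dy v t x y ^ 2); (ContDiffOn ℝ 2 (fun q : ℝ × ℝ × ℝ => u q.1 q.2.1 q.2.2) (Set.Ioi 0 ×ˢ Set.univ) ∧ ContDiffOn ℝ 2 (fun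 q : ℝ × ℝ × ℝ => v q.1 q.2.1 q.2.2) (Set.Ioi 0 ×ˢ Set.univ) ∧ ContDiffOn ℝ 1 (fun q : ℝ × ℝ × ℝ => p q.1 q.2.1 q.2.2) (Set.Ioi 0 ×ˢ Set.univ) ∧ ContinuousOn (fun q : ℝ × ℝ × ℝ => u q.1 q.2.1 q.2.2) (Set.Ici 0 ×ˢ Set.univ) ∧ ContinuousOn (fun q : ℝ × ℝ × ℝ => v q.1 q.2.1 q.2.2) (Set.Ici 0 ×ˢ Set.univ) ∧ (∀ t x y, 0 < t → Dt u t x y + u t x y * Dx u t x y + (v t x y - y) * Dy u t x y = -Dx p t x y + ν * (Dx (Dx u) t x y + Dy (Dy u) t x y) ∧ Dt v t x y + u t x y * Dx v t x y + (v t x y - y) * Dy v t x y - v t x y = -Dy p t x y + ν * (Dx (Dx v) t x y + Dy (Dy v) t x y) ∧ Dx u t x y + Dy v t x y = 0) ∧ (∀ t x y, 0 ≤ t → u t (x + L) y = u t x y ∧ v t (x + L) y = v t x y ∧ p t (x + L) y = p t x y) ∧ (∀ t x, 0 ≤ t → Tendsto (fun y => u t x y) atTop (nhds (1 / 2)) ∧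 Tendsto (fun y => u t x y) atBot (nhds (-(1 / 2))) ∧ Tendsto (fun y => v t x y) atTop (nhds 0) ∧ Tendsto (fun y => v t x y) atBot (nhds 0)) ∧ (∀ x y, u 0 x y = UB y + θ₁ x y ∧ v 0 x y = θ₂ x y)) → ENNReal.ofReal (c * min L 1) ≤ Filter.liminf (fun T : ℝ => ENNReal.ofReal T⁻¹ * ∫⁻ t in Set.Ioc 0 T, D t) Filter.atTop

/-- **The crux, decomposed** (definitional up to `∧`-reassociation):
`StrainedLayerLaw ↔ ∃ c > 0, ∀ L > 0, ∃ ν₀ > 0, ∃ θ admissible, ∀ ν ∈ (0, ν₀], LawAt c L ν θ`. -/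
theorem strainedLayerLaw_iff :
    StrainedLayerLaw ↔ ∃ c : ℝ, 0 < c ∧ ∀ L : ℝ, 0 < L → ∃ ν₀ : ℝ, 0 < ν₀ ∧ ∃ θ₁ θ₂ : ℝ → ℝ → ℝ,
      AdmissibleTheta L θ₁ θ₂ ∧ ∀ ν : ℝ, 0 < ν → ν ≤ ν₀ → LawAt c L ν θ₁ θ₂ := by
  unfold StrainedLayerLaw AdmissibleTheta LawAt
  simp only [and_assoc]

/-- `θ = 0` is admissible (so the `∃ θ` of the crux is never vacuous, for every `L`). -/
theorem admissibleTheta_zero (L : ℝ) : AdmissibleTheta L (fun _ _ => 0) (fun _ _ => 0) := by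
  refine ⟨contDiff_const, contDiff_const, fun _ _ => ⟨rfl, rfl⟩, ⟨0, fun _ _ _ => ⟨rfl, rfl⟩⟩, ?_⟩
  intro x y
  simp

/-! ## §2 The perturbation is load-bearing: the unperturbed Burgers layer persists -/

/-- The crux's inlined initial profile `U_B^ν(y) = (2πν)^{-1/2} ∫₀^y e^{−s²/(2ν)} ds` (verbatim). -/
def ub (ν : ℝ) (y : ℝ) : ℝ :=
  (Real.sqrt (2 * Real.pi * ν))⁻¹ * ∫ s in (0:ℝ)..y, Real.exp (-(s ^ 2) / (2 * ν))

/-- `U_B^ν` is the tree's Burgers layer profile with `γ = ΔU = 1`: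
`ub ν = burgersLayerProfile 1 ν 1` (`ν > 0`; substitution `t = s (2ν)^{-1/2}`). -/
theorem ub_eq {ν : ℝ} (hν : 0 < ν) : ub ν = burgersLayerProfile 1 ν 1 := by
  funext y
  set κ := burgersLayerRate 1 ν with hκdef
  have hκ : 0 < κ := burgersLayerRate_pos one_pos hν
  have hκ2 : κ ^ 2 = 1 / (2 * ν) := burgersLayerRate_sq (by positivity)
  have h1 : ∫ t in (0:ℝ)..(κ * y), Real.exp (-t ^ 2) =
      κ * ∫ s in (0:ℝ)..y, Real.exp (-(s ^ 2) / (2 * ν)) := by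
    have h := intervalIntegral.smul_integral_comp_mul_left (fun t : ℝ => Real.exp (-t ^ 2)) κ
      (a := (0:ℝ)) (b := y)
    simp only [mul_zero, smul_eq_mul] at h
    rw [← h]
    congr 1
    refine intervalIntegral.integral_congr fun s _ => ?_
    show Real.exp (-(κ * s) ^ 2) = Real.exp (-(s ^ 2) / (2 * ν))
    congr 1
    rw [mul_pow, hκ2]
    field_simp
  have hκ' : κ = (Real.sqrt (2 * ν))⁻¹ := by
    rw [hκdef, burgersLayerRate, Real.sqrt_div' _ (by positivity : (0:ℝ) ≤ 2 * ν)]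
    simp
  unfold ub burgersLayerProfile
  rw [h1, ← mul_assoc]
  congr 1
  rw [hκ', show (2 * Real.pi * ν) = Real.pi * (2 * ν) by ring,
    Real.sqrt_mul Real.pi_pos.le]
  have hπ : Real.sqrt Real.pi ≠ 0 := (Real.sqrt_pos.2 Real.pi_pos).ne'
  have h2ν : Real.sqrt (2 * ν) ≠ 0 := (Real.sqrt_pos.2 (by positivity)).ne'
  field_simp


/-! ### The Burgers layer with `γ = ΔU = 1`: derivative bookkeeping and its dissipation -/

/-- `U_B' = burgersLayerProfileD 1 ν 1` (as functions). -/
theorem deriv_bLP (ν : ℝ) : deriv (burgersLayerProfile 1 ν 1) = burgersLayerProfileD 1 ν 1 :=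
  funext fun s => (hasDerivAt_burgersLayerProfile' 1 ν 1 s).deriv

/-- `U_B'' = burgersLayerProfileDD 1 ν 1` (as functions). -/
theorem deriv_bLPD (ν : ℝ) : deriv (burgersLayerProfileD 1 ν 1) = burgersLayerProfileDD 1 ν 1 :=
  funext fun s => (hasDerivAt_burgersLayerProfileD 1 ν 1 s).deriv

/-- `(U_B')² = (2πν)⁻¹ e^{−y²/ν}` (a Gaussian). -/
theorem bLPD_sq {ν : ℝ} (hν : 0 < ν) (s : ℝ) :
    burgersLayerProfileD 1 ν 1 s ^ 2 = 1 / Real.pi * (1 / (2 * ν)) * Real.exp (-(1 / ν) * s ^ 2) := by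
  have h := deriv_burgersLayerProfile_sq (γ := 1) (ν := ν) (by positivity) 1 s
  rw [deriv_bLP, one_pow] at h
  exact h

/-- `(U_B')²` is integrable on `ℝ`. -/
theorem integrable_bLPD_sq {ν : ℝ} (hν : 0 < ν) :
    Integrable (fun s => burgersLayerProfileD 1 ν 1 s ^ 2) := by
  simp_rw [bLPD_sq hν]
  exact (integrable_exp_neg_mul_sq (by positivity : 0 < 1 / ν)).const_mul _

/-- **Laminar dissipation per unit area** in the crux's normalisation: `ν ∫ (U_B')² = √ν/(2√π) = (ν/4π)^{1/2}`
(the Sweet–Parker rung; `burgersLayer_dissipation` with `γ = ΔU = 1`). -/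
theorem nu_mul_integral_bLPD_sq {ν : ℝ} (hν : 0 < ν) :
    ν * ∫ s, burgersLayerProfileD 1 ν 1 s ^ 2 = Real.sqrt ν / (2 * Real.sqrt Real.pi) := by
  have h := burgersLayer_dissipation one_pos hν (1 : ℝ)
  rw [deriv_bLP] at h
  simpa using h

/-- The `lintegral` of `(U_B')²` is the `ofReal` of its Bochner integral (nonnegative integrable integrand). -/
theorem lintegral_bLPD_sq {ν : ℝ} (hν : 0 < ν) :
    ∫⁻ s, ENNReal.ofReal (burgersLayerProfileD 1 ν 1 s ^ 2) =
      ENNReal.ofReal (∫ s, burgersLayerProfileD 1 ν 1 s ^ 2) :=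
  (ofReal_integral_eq_lintegral_ofReal (integrable_bLPD_sq hν)
    (Eventually.of_forall fun _ => sq_nonneg _)).symm

/-- **The Cesàro `liminf` of a constant-in-time dissipation is that constant** (`T⁻¹ · (K · T) = K` for
`T > 0`). Reusable by provers for any steady member of the class. -/
theorem liminf_timeMean_const (K : ℝ≥0∞) :
    Filter.liminf (fun T : ℝ => ENNReal.ofReal T⁻¹ * ∫⁻ _ in Set.Ioc 0 T, K) Filter.atTop = K := by
  have h : ∀ᶠ T : ℝ in atTop, ENNReal.ofReal T⁻¹ * ∫⁻ _ in Set.Ioc 0 T, K = K := by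
    filter_upwards [eventually_gt_atTop 0] with T hT
    rw [setLIntegral_const, Real.volume_Ioc, sub_zero, mul_comm K, ← mul_assoc,
      ← ENNReal.ofReal_mul (inv_nonneg.2 hT.le), inv_mul_cancel₀ hT.ne', ENNReal.ofReal_one, one_mul]
  rw [Filter.liminf_congr h, Filter.liminf_const]

/-- **The crux's `D(t)` evaluated on the Burgers layer** (`u = U_B(y)`, `v = 0`): the constant
`ofReal (√ν/(2√π))`, for every `t` and every period `L > 0`. -/
theorem layerD_burgers {ν L : ℝ} (hν : 0 < ν) (hL : 0 < L) :
    ENNReal.ofReal (ν / L) * ∫⁻ x in Set.Ioc 0 L, ∫⁻ y,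
      ENNReal.ofReal (deriv (fun _ : ℝ => burgersLayerProfile 1 ν 1 y) x ^ 2 +
        deriv (fun s => burgersLayerProfile 1 ν 1 s) y ^ 2 +
        deriv (fun _ : ℝ => (0 : ℝ)) x ^ 2 + deriv (fun _ : ℝ => (0 : ℝ)) y ^ 2) =
      ENNReal.ofReal (Real.sqrt ν / (2 * Real.sqrt Real.pi)) := by
  have hJ : 0 ≤ ∫ s, burgersLayerProfileD 1 ν 1 s ^ 2 := integral_nonneg fun s => sq_nonneg _
  simp only [deriv_const, deriv_bLP, ne_eq, OfNat.ofNat_ne_zero, not_false_eq_true, zero_pow,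
    zero_add, add_zero]
  rw [lintegral_bLPD_sq hν, setLIntegral_const, Real.volume_Ioc, sub_zero,
    ← ENNReal.ofReal_mul hJ, ← ENNReal.ofReal_mul (div_nonneg hν.le hL.le)]
  congr 1
  rw [show ν / L * ((∫ s, burgersLayerProfileD 1 ν 1 s ^ 2) * L) =
      ν * ∫ s, burgersLayerProfileD 1 ν 1 s ^ 2 by field_simp]
  exact nu_mul_integral_bLPD_sq hν

/-- **The Burgers layer solves the crux's inlined momentum balance**: `−y U_B' = ν U_B''`
(`burgersLayerProfile_ode` with `γ = 1`). -/
theorem bLP_momentum (ν y : ℝ) :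
    (0 - y) * burgersLayerProfileD 1 ν 1 y = ν * burgersLayerProfileDD 1 ν 1 y := by
  have h := burgersLayerProfile_ode 1 ν 1 y
  linarith

/-- **LOAD-BEARING `∃ θ` — the unperturbed layer persists.** For `θ = 0` the Burgers layer
`u = U_B^ν(y)`, `v = 0`, `p = 0` is a global classical solution in the crux's class (so the hypothesis
list is satisfiable: NON-VACUITY in the crux's own normalisation), and its Cesàro-liminf dissipation is
the laminar value `√ν/(2√π) = (ν/4π)^{1/2}`; hence `LawAt c L ν 0 0` FAILS as soon as
`√ν < 2√π · c · min(L,1)`. Consequently any proof of the crux must use its perturbation `θ`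
non-trivially (and, by §4, an `x`-DEPENDENT one). [folklore: Burgers 1948; MajdaBertozzi2002 §1.4 Ex. 1.8] -/
theorem lawAt_zero_false {c L ν : ℝ} (hL : 0 < L) (hν : 0 < ν)
    (hsmall : Real.sqrt ν < 2 * Real.sqrt Real.pi * (c * min L 1)) :
    ¬ LawAt c L ν (fun _ _ => 0) (fun _ _ => 0) := by
  intro hlaw
  have h := hlaw (fun _ _ y => burgersLayerProfile 1 ν 1 y) (fun _ _ _ => 0) (fun _ _ _ => 0)
  dsimp only at h
  have hU : ContDiff ℝ 2 (burgersLayerProfile 1 ν 1) :=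
    contDiff_infty.1 (contDiff_burgersLayerProfile 1 ν 1) 2
  have hU3 : ContDiff ℝ 2 (fun q : ℝ × ℝ × ℝ => burgersLayerProfile 1 ν 1 q.2.2) :=
    hU.comp (contDiff_snd.comp contDiff_snd)
  have key := h ⟨hU3.contDiffOn, contDiffOn_const, contDiffOn_const, hU3.continuous.continuousOn,
    continuousOn_const, ?pde, fun _ _ _ _ => ⟨rfl, rfl, rfl⟩, ?far, ?datum⟩
  case pde =>
    intro t x y _
    refine ⟨?_, ?_, ?_⟩
    · simp only [deriv_const, deriv_bLP, deriv_bLPD, mul_zero, zero_add, neg_zero]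
      exact bLP_momentum ν y
    · simp
    · simp
  case far =>
    intro t x _
    exact ⟨tendsto_burgersLayerProfile_atTop one_pos hν 1, tendsto_burgersLayerProfile_atBot one_pos hν 1,
      tendsto_const_nhds, tendsto_const_nhds⟩
  case datum =>
    intro x y
    refine ⟨?_, rfl⟩
    show burgersLayerProfile 1 ν 1 y = ub ν y + 0
    rw [add_zero, ub_eq hν]
  -- the conclusion evaluates to `ofReal (c·min L 1) ≤ ofReal (√ν/(2√π))`
  have hlim : Filter.liminf (fun T : ℝ => ENNReal.ofReal T⁻¹ * ∫⁻ _ in Set.Ioc 0 T,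
      ENNReal.ofReal (ν / L) * ∫⁻ x in Set.Ioc 0 L, ∫⁻ y,
        ENNReal.ofReal (deriv (fun _ : ℝ => burgersLayerProfile 1 ν 1 y) x ^ 2 +
          deriv (fun s => burgersLayerProfile 1 ν 1 s) y ^ 2 +
          deriv (fun _ : ℝ => (0 : ℝ)) x ^ 2 + deriv (fun _ : ℝ => (0 : ℝ)) y ^ 2)) Filter.atTop =
      ENNReal.ofReal (Real.sqrt ν / (2 * Real.sqrt Real.pi)) := by
    rw [layerD_burgers hν hL, liminf_timeMean_const]
  have key' := key.trans_eq hlim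
  rw [ENNReal.ofReal_le_ofReal_iff (by positivity)] at key'
  have h2 : 0 < 2 * Real.sqrt Real.pi := by positivity
  have : Real.sqrt ν / (2 * Real.sqrt Real.pi) < c * min L 1 := by
    rw [div_lt_iff₀ h2]; linarith
  linarith

/-- For every `c, L > 0` and every `ν₀ > 0` there is an admissible viscosity `ν ∈ (0, ν₀]` at which
the unperturbed law fails (take `ν = min ν₀ (π (c·min(L,1))²)`). -/
theorem exists_nu_lawAt_zero_false {c L ν₀ : ℝ} (hc : 0 < c) (hL : 0 < L) (hν₀ : 0 < ν₀) :
    ∃ ν : ℝ, 0 < ν ∧ ν ≤ ν₀ ∧ ¬ LawAt c L ν (fun _ _ => 0) (fun _ _ => 0) := by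
  set m := c * min L 1 with hm
  have hmpos : 0 < m := mul_pos hc (lt_min hL one_pos)
  refine ⟨min ν₀ (Real.pi * m ^ 2), lt_min hν₀ (by positivity), min_le_left _ _,
    lawAt_zero_false hL (lt_min hν₀ (by positivity)) ?_⟩
  have h1 : Real.sqrt (min ν₀ (Real.pi * m ^ 2)) ≤ Real.sqrt (Real.pi * m ^ 2) :=
    Real.sqrt_le_sqrt (min_le_right _ _)
  have h2 : Real.sqrt (Real.pi * m ^ 2) = Real.sqrt Real.pi * m := by
    rw [Real.sqrt_mul Real.pi_pos.le, Real.sqrt_sq hmpos.le]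
  have h3 : 0 < Real.sqrt Real.pi * m := mul_pos (Real.sqrt_pos.2 Real.pi_pos) hmpos
  linarith

/-- **The natural strengthening "for EVERY admissible θ" is FALSE** (already at `θ = 0`, for every
`c, L, ν₀`): the crux is a statement about ONE well-chosen perturbation, not about generic data, and no
law of this form holds for the unperturbed layer. -/
theorem not_strainedLayerLaw_forall_theta :
    ¬ ∃ c : ℝ, 0 < c ∧ ∀ L : ℝ, 0 < L → ∃ ν₀ : ℝ, 0 < ν₀ ∧ ∀ θ₁ θ₂ : ℝ → ℝ → ℝ,
      AdmissibleTheta L θ₁ θ₂ → ∀ ν : ℝ, 0 < ν → ν ≤ ν₀ → LawAt c L ν θ₁ θ₂ := by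
  rintro ⟨c, hc, h⟩
  obtain ⟨ν₀, hν₀, hall⟩ := h 1 one_pos
  obtain ⟨ν, hν, hle, hfalse⟩ := exists_nu_lawAt_zero_false hc one_pos hν₀
  exact hfalse (hall _ _ (admissibleTheta_zero 1) ν hν hle)

/-- **The `θ = 0` instance of the crux is FALSE**: with the perturbation pinned to zero (i.e. the crux
with its `∃ θ₁ θ₂, …` witnessed by `0, 0`) the statement fails for every `c`. -/
theorem not_strainedLayerLaw_theta_zero :
    ¬ ∃ c : ℝ, 0 < c ∧ ∀ L : ℝ, 0 < L → ∃ ν₀ : ℝ, 0 < ν₀ ∧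
      ∀ ν : ℝ, 0 < ν → ν ≤ ν₀ → LawAt c L ν (fun _ _ => 0) (fun _ _ => 0) := by
  rintro ⟨c, hc, h⟩
  obtain ⟨ν₀, hν₀, hall⟩ := h 1 one_pos
  obtain ⟨ν, hν, hle, hfalse⟩ := exists_nu_lawAt_zero_false hc one_pos hν₀
  exact hfalse (hall ν hν hle)


/-! ## §3 Symmetries, hypothesis mutation, and a mechanism sanity check

HYPOTHESIS MUTATION (paper analysis, refuter cycle 1; no cheap model breaks any single dropped clause
because the prover's `∃ θ` blocks every explicit construction except parallel flows):
* `p (x+L) = p`: a non-periodic `p = −a'(t)x + periodic` is a uniform `x`-force; it accelerates the far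
  field, so it is ALREADY excluded by `u → ±1/2` (∀ t ≥ 0). Possibly redundant (information for the prover).
* `v → 0` at `±∞`: excludes `p ∼ b(t)·y` (uniform `y`-force ⇒ uniform `v`-drift `V' − V = b`). Needed.
* DECAYING `y`-TRANSLATION SYMMETRY: if `(u,v,p)(t,x,y)` solves the stretched system then so does
  `(u,v,p)(t,x,y − h₀e^{−t})` for every `h₀ ∈ ℝ` (the compression returns a displaced layer to `y = 0`
  at rate `γ = 1`; check: `∂ₜ[u(t,x,y−h)] = uₜ − h'u_Y`, `(v − y)u_Y = (v − Y)u_Y − h u_Y`, so the extra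
  terms are `−(h' + h)u_Y = 0` iff `h = h₀e^{−t}`; the `v`-equation likewise, `p` unchanged). It preserves
  periodicity, the far field and — being a translation — the dissipation `D(t)` EXACTLY; it changes the
  datum to `U_B(y − h₀) + θ(x, y − h₀)`. So the far-field clauses do not pin the layer's position, but `D`
  is blind to it: harmless for the crux, and a free normalisation for provers.
* Galilean `x`-boosts change the far field (`±1/2 + a`): excluded. Scaling `(x,y,u,ν) ↦ (λx,λy,λu,λ²ν)`
  changes `ΔU`: excluded by the normalisation `ΔU = 1`.
* ENSTROPHY LAW of the class (for provers; formal only): `d/dt ½∫∫ω² = ½∫∫ω² − ν∫∫|∇ω|²` per period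
  (transport by a field of divergence `−1` plus stretching `+ω`): NO 2-D enstrophy ceiling — this is
  exactly how the line evades `Literature.Barriers.AnomalousDissipation.AlexakisDoering2006_energyDissipationBound`,
  and `D = (ν/L)∫∫ω²` (the cross terms are boundary terms that vanish for the class).
-/

/-- **Mechanism sanity check (point-vortex model, refuter's own; addresses the planner's "pairing may
arrest early").** Linearising Lamb's single row of identical point vortices (strength `κ`, spacing `a`,
Lamb *Hydrodynamics* §156) about the row, a displacement mode `ζₘ = (ξ + iη)e^{imφ}` obeys
`ξ' = −Bη`, `η' = −Bξ` with `B = κφ(2π−φ)/(4πa²) > 0` (pairing: `φ = π`, `B = κπ/(4a²)`); the compression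
`(0, −γy)` of the crux's strain adds `−γη` to `η'` (γ = 1 here) and nothing to `ξ'` (no strain along `x`).
This lemma: the strained system `ξ' = −Bη`, `η' = −Bξ − η` STILL has a positive growth rate
`σ = (√(1+4B²) − 1)/2` (root of `σ² + σ = B²`) with a non-trivial eigenvector, for EVERY `B > 0`. So in the
point-vortex idealisation the strain slows pairing (`σ ≈ B²` for `B ≪ 1`, i.e. spacing `≫ κ/γ`) but never
arrests it: a strained row coarsens until ONE vortex per period remains (the `L`-periodic class forbids the
next subharmonic), whose Burgers dissipation per area is `γΓ²/(8πL) = L/8π` with `Γ = ΔU·L` — consistent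
with (indeed above, for `L > 1`) the crux's `c·min(L,1)`. Informative, not a refutation. [folklore] -/
theorem strainedRow_pairing_unstable {B : ℝ} (hB : 0 < B) :
    ∃ σ : ℝ, 0 < σ ∧ ∃ ξ η : ℝ, (ξ ≠ 0 ∨ η ≠ 0) ∧ σ * ξ = -B * η ∧ σ * η = -B * ξ - η := by
  set r := Real.sqrt (1 + 4 * B ^ 2) with hr
  have hr1 : 1 < r := by
    rw [hr]
    exact (Real.lt_sqrt zero_le_one).2 (by nlinarith)
  have hrsq : r ^ 2 = 1 + 4 * B ^ 2 := by rw [hr, Real.sq_sqrt (by positivity)]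
  refine ⟨(r - 1) / 2, by linarith, B, -((r - 1) / 2), Or.inl hB.ne', by ring, ?_⟩
  nlinarith [hrsq]

/-- **Dissipation bookkeeping of the intended terminal state** (arithmetic only): `N` stretched Burgers
vortices per period `L`, each of circulation `Γ = L/N` and `ν`-independent dissipation `γΓ²/(8π)`
(Davidson 2001 p.179; `γ = 1`), give dissipation per unit area `(1/L)·N·Γ²/(8π) = (L/N)/(8π)` = spacing/8π:
coarsening RAISES `D`, and the law `≥ c·min(L,1)` needs a terminal spacing `≥ 8πc·min(L,1)`. [folklore] -/
theorem row_dissipation_per_area {L : ℝ} {N : ℕ} (hL : 0 < L) (hN : 0 < N) :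
    (1 / L) * (N * ((L / N) ^ 2 / (8 * Real.pi))) = (L / N) / (8 * Real.pi) := by
  have hN' : (0 : ℝ) < N := by exact_mod_cast hN
  field_simp

/-! ## §4 Near-misses and reductions (no `sorry` used so far)

* x-INDEPENDENT PERTURBATIONS RELAMINARISE (reduction, `lawAt_parallel_false_of_relaxation` below): for
  `θ = (g(y), 0)` (admissible iff `g ∈ C²` with compact support) the parallel flow `u = U(t,y)`, `v = p = 0`
  with `Uₜ = yU_y + νU_yy`, `U(0) = U_B + g` (Majda–Bertozzi 2002 (1.34): an explicit Mehler/OU formula)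
  is a member of the crux's class, and its dissipation relaxes to the laminar `√ν/(2√π)` (the vorticity
  perturbation obeys the Fokker–Planck equation `wₜ = (yw)_y + νw_yy` with zero mass, spectral gap `1`).
  The theorem below is the sorry-free PLUMBING: the 1-D relaxation statement `ParallelRelaxes` implies
  `¬ LawAt` at that θ. Discharging `ParallelRelaxes` (classical regularity of the Mehler solution + the
  limit of `ν∫U_y²`) is Literature-grade work (OU semigroup; cf. `AncientSimilarityVorticity` in tree) and
  is left open here. CONSEQUENCE for provers: the crux's θ must depend on `x`.
* UNIQUENESS GHOSTS (M3 of the route review): the class fixes no growth/integrability of `ω`; a second,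
  non-physical solution from the same datum (vorticity entering from `|y| = ∞` along the inflow `−y∂_y`,
  cf. the algebraic steady tails `|ω_k| ∼ |y|^{−1+νk²}` of the linearised mode-`k` problem) would falsify
  the crux for a non-physical reason. No construction found: for integrable vorticity the 1-D problem is
  a Fokker–Planck equation with unique mild solutions, and the pointwise velocity limits force
  `∫|ω| dy`-type control only heuristically. OPEN; recommended side condition (already suggested by the
  route review): `ω(t,·) ∈ L¹ ∩ L^∞` of the period strip, locally uniformly in `t`.
-/

/-- **1-D relaxation statement** for the strained heat equation from `U_B + g`: there is a classical
solution `U(t, y)` (C² on `t > 0`, continuous up to `t = 0`) of `Uₜ = yU_y + νU_yy` with `U(0) = U_B^ν + g`,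
far field `±1/2` for all `t ≥ 0`, whose Cesàro-liminf dissipation (in the crux's `ℝ≥0∞` form, with the
trivial `x`-integration over a period `L`) is `< c·min(L,1)`. TRUE for every compactly supported `C²`
`g` and `ν` small — not proved here. ROUTE TO A PROOF (for whoever discharges it): the substitution
`U(t,y) = W(s, η)`, `η = y eᵗ`, `s = ν(e^{2t} − 1)/2` turns `Uₜ = yU_y + νU_yy` into the HEAT EQUATION
`W_s = W_ηη` with `W(0) = U_B^ν + g` (the Burgers layer is the self-similar erf: heat flow widens its
variance to `ν e^{2t}`, the rescaling `η = y eᵗ` shrinks it back to `ν`); the perturbation gradient is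
`eᵗ (e^{sΔ} g')(y eᵗ)` with `∫ g' = 0`, so `‖U_y − U_B'‖²_{L²} = eᵗ ‖e^{sΔ}g'‖²_{L²} = O(e^{−2t})` and
`D(t) → √ν/(2√π)` exponentially; Cesàro means follow. [folklore] -/
def ParallelRelaxes (ν L c : ℝ) (g : ℝ → ℝ) : Prop :=
  ∃ U : ℝ → ℝ → ℝ,
    ContDiffOn ℝ 2 (fun q : ℝ × ℝ => U q.1 q.2) (Set.Ioi 0 ×ˢ Set.univ) ∧
    ContinuousOn (fun q : ℝ × ℝ => U q.1 q.2) (Set.Ici 0 ×ˢ Set.univ) ∧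
    (∀ t y, 0 < t → deriv (fun s => U s y) t = y * deriv (U t) y + ν * deriv (deriv (U t)) y) ∧
    (∀ t, 0 ≤ t → Tendsto (U t) atTop (nhds (1 / 2)) ∧ Tendsto (U t) atBot (nhds (-(1 / 2)))) ∧
    (∀ y, U 0 y = ub ν y + g y) ∧
    Filter.liminf (fun T : ℝ => ENNReal.ofReal T⁻¹ * ∫⁻ t in Set.Ioc 0 T,
      ENNReal.ofReal (ν / L) * ∫⁻ _ in Set.Ioc 0 L, ∫⁻ y, ENNReal.ofReal (deriv (U t) y ^ 2)) Filter.atTop <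
      ENNReal.ofReal (c * min L 1)

/-- **x-independent perturbations cannot carry the law (reduction to 1-D).** If the strained heat flow
from `U_B + g` relaxes (`ParallelRelaxes ν L c g`), then the crux's law FAILS at the admissible
perturbation `θ = (g(y), 0)`: the parallel flow `(U(t,y), 0, 0)` is a global classical solution in the
crux's class with too little dissipation. Sorry-free plumbing; the analytic input is isolated in
`ParallelRelaxes`. [folklore] -/
theorem lawAt_parallel_false_of_relaxation {ν L c : ℝ} {g : ℝ → ℝ}
    (h : ParallelRelaxes ν L c g) : ¬ LawAt c L ν (fun _ y => g y) (fun _ _ => 0) := by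
  obtain ⟨U, hC2, hC0, hpde, hfar, hdat, hlim⟩ := h
  intro hlaw
  have h := hlaw (fun t _ y => U t y) (fun _ _ _ => 0) (fun _ _ _ => 0)
  dsimp only at h
  have hmap : ∀ S : Set ℝ, MapsTo (fun q : ℝ × ℝ × ℝ => (q.1, q.2.2)) (S ×ˢ (univ : Set (ℝ × ℝ)))
      (S ×ˢ (univ : Set ℝ)) := fun S q hq => ⟨hq.1, mem_univ _⟩
  have hproj : ContDiff ℝ 2 (fun q : ℝ × ℝ × ℝ => (q.1, q.2.2)) :=
    contDiff_fst.prodMk (contDiff_snd.comp contDiff_snd)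
  have hC2' : ContDiffOn ℝ 2 (fun q : ℝ × ℝ × ℝ => U q.1 q.2.2) (Set.Ioi 0 ×ˢ Set.univ) :=
    hC2.comp hproj.contDiffOn (hmap _)
  have hC0' : ContinuousOn (fun q : ℝ × ℝ × ℝ => U q.1 q.2.2) (Set.Ici 0 ×ˢ Set.univ) :=
    hC0.comp hproj.continuous.continuousOn (hmap _)
  have key := h ⟨hC2', contDiffOn_const, contDiffOn_const, hC0', continuousOn_const, ?pde,
    fun _ _ _ _ => ⟨rfl, rfl, rfl⟩, ?far, ?datum⟩
  case pde =>
    intro t x y ht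
    refine ⟨?_, ?_, ?_⟩
    · simp only [deriv_const, mul_zero, add_zero, neg_zero, zero_add, zero_sub]
      rw [hpde t y ht]
      ring
    · simp
    · simp
  case far =>
    intro t x ht
    exact ⟨(hfar t ht).1, (hfar t ht).2, tendsto_const_nhds, tendsto_const_nhds⟩
  case datum =>
    intro x y
    exact ⟨hdat y, rfl⟩
  have key' : ENNReal.ofReal (c * min L 1) ≤ Filter.liminf (fun T : ℝ => ENNReal.ofReal T⁻¹ *
      ∫⁻ t in Set.Ioc 0 T, ENNReal.ofReal (ν / L) * ∫⁻ _ in Set.Ioc 0 L, ∫⁻ y,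
        ENNReal.ofReal (deriv (U t) y ^ 2)) Filter.atTop := by
    refine key.trans_eq ?_
    congr 1
    funext T
    congr 1
    refine lintegral_congr fun t => ?_
    congr 1
    refine lintegral_congr fun x => ?_
    refine lintegral_congr fun y => ?_
    simp
  exact absurd key' (not_le.2 hlim)

/-! ### §4b The breathing Burgers layer: `ParallelRelaxes` DISCHARGED for the thick-layer datum

An explicit UNSTEADY exact member of the crux's class (Majda–Bertozzi 2002 §1.4 Ex. 1.7: a Gaussian
strained shear layer of the "wrong" thickness relaxes to the Burgers layer): with variance
`s(t) = ν + (μ − ν)e^{−2t}` (`s' = 2ν − 2s`, `s(0) = μ`, `s(∞) = ν`) the field `U(t,y) = U_B^{s(t)}(y)`,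
`v = p = 0`, solves `Uₜ = yU_y + νU_yy` with far field `±1/2`; its dissipation slice is
`ν/(2√π √s(t)) ≤ √ν/(2√π)` for `μ ≥ ν`. Hence `ParallelRelaxes ν L c (U_B^μ − U_B^ν)` holds and, by the
§4 reduction, the law FAILS for the (x-independent, Gaussian-tailed, non-compactly-supported)
perturbation `θ = (U_B^μ − U_B^ν, 0)`: starting the crux from a FIXED ν-independent smooth shear layer
`U_B^μ` instead of `U_B^ν` does not rescue the θ = 0 case — the layer simply thins to `√ν` and sits at
the Sweet–Parker rung. (Not an admissible θ of the crux: compact support fails; recorded as the first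
non-trivial discharge of `ParallelRelaxes` and a second exact solution family for provers' tests.)
-/

/-- Variance of the breathing layer: `s(t) = ν + (μ − ν) e^{−2t}`. [folklore] -/
def bvar (μ ν t : ℝ) : ℝ := ν + (μ - ν) * Real.exp (-2 * t)

/-- `s(t) ≥ ν` for `μ ≥ ν`. [folklore] -/
theorem nu_le_bvar {μ ν : ℝ} (hμ : ν ≤ μ) (t : ℝ) : ν ≤ bvar μ ν t := by
  unfold bvar
  have := Real.exp_pos (-2 * t)
  nlinarith

/-- `s(t) > 0` for `0 < ν ≤ μ`. [folklore] -/
theorem bvar_pos {μ ν : ℝ} (hν : 0 < ν) (hμ : ν ≤ μ) (t : ℝ) : 0 < bvar μ ν t :=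
  hν.trans_le (nu_le_bvar hμ t)

/-- `s(0) = μ`. [folklore] -/
@[simp] theorem bvar_zero (μ ν : ℝ) : bvar μ ν 0 = μ := by simp [bvar]

/-- `s' = −2(μ − ν)e^{−2t}`. [folklore] -/
theorem hasDerivAt_bvar (μ ν t : ℝ) :
    HasDerivAt (bvar μ ν) (-2 * (μ - ν) * Real.exp (-2 * t)) t := by
  have h1 : HasDerivAt (fun x : ℝ => -2 * x) (-2) t := by
    simpa using (hasDerivAt_id t).const_mul (-2 : ℝ)
  have h2 : HasDerivAt (fun x : ℝ => Real.exp (-2 * x)) (Real.exp (-2 * t) * -2) t := h1.exp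
  have h3 : HasDerivAt (fun x : ℝ => ν + (μ - ν) * Real.exp (-2 * x))
      ((μ - ν) * (Real.exp (-2 * t) * -2)) t := (h2.const_mul (μ - ν)).const_add ν
  have h4 : HasDerivAt (bvar μ ν) ((μ - ν) * (Real.exp (-2 * t) * -2)) t := h3
  refine h4.congr_deriv ?_
  ring

/-- `s' = 2ν − 2s` (the variance ODE of the strained heat flow). [folklore] -/
theorem hasDerivAt_bvar' (μ ν t : ℝ) :
    HasDerivAt (bvar μ ν) (2 * ν - 2 * bvar μ ν t) t := by
  refine (hasDerivAt_bvar μ ν t).congr_deriv ?_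
  simp only [bvar]
  ring

/-- `s` is smooth. [folklore] -/
theorem contDiff_bvar (μ ν : ℝ) {n : WithTop ℕ∞} : ContDiff ℝ n (bvar μ ν) := by
  unfold bvar
  fun_prop

/-- The inverse length `κ(t) = (2s(t))^{-1/2} = burgersLayerRate 1 (s t)`. [folklore] -/
def bkap (μ ν t : ℝ) : ℝ := burgersLayerRate 1 (bvar μ ν t)

/-- `κ² = 1/(2s)`. [folklore] -/
theorem bkap_sq {μ ν : ℝ} (hν : 0 < ν) (hμ : ν ≤ μ) (t : ℝ) :
    bkap μ ν t ^ 2 = 1 / (2 * bvar μ ν t) :=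
  burgersLayerRate_sq (by have := bvar_pos hν hμ t; positivity)

/-- `κ > 0`. [folklore] -/
theorem bkap_pos {μ ν : ℝ} (hν : 0 < ν) (hμ : ν ≤ μ) (t : ℝ) : 0 < bkap μ ν t :=
  burgersLayerRate_pos one_pos (bvar_pos hν hμ t)

/-- `2κ²s = 1`. [folklore] -/
theorem two_mul_bkap_sq_mul_bvar {μ ν : ℝ} (hν : 0 < ν) (hμ : ν ≤ μ) (t : ℝ) :
    2 * bkap μ ν t ^ 2 * bvar μ ν t = 1 := by
  rw [bkap_sq hν hμ]
  have := (bvar_pos hν hμ t).ne'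
  field_simp

/-- `κ'` in chain-rule form: `κ = √((2s)⁻¹)`, so `κ' = (−(2 s'))/(2s)² / (2κ)` with `s' = 2ν − 2s`.
[folklore] -/
theorem hasDerivAt_bkap {μ ν : ℝ} (hν : 0 < ν) (hμ : ν ≤ μ) (t : ℝ) :
    HasDerivAt (bkap μ ν)
      ((-(2 * (2 * ν - 2 * bvar μ ν t)) / (2 * bvar μ ν t) ^ 2) / (2 * bkap μ ν t)) t := by
  have hs : 0 < bvar μ ν t := bvar_pos hν hμ t
  have hf : HasDerivAt (fun t => (2 * bvar μ ν t)⁻¹)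
      (-(2 * (2 * ν - 2 * bvar μ ν t)) / (2 * bvar μ ν t) ^ 2) t :=
    ((hasDerivAt_bvar' μ ν t).const_mul 2).inv (by positivity)
  have hsqrt := hf.sqrt (inv_ne_zero (by positivity))
  have heq : (fun t => Real.sqrt ((2 * bvar μ ν t)⁻¹)) = bkap μ ν := by
    funext t; simp only [bkap, burgersLayerRate, one_div]
  have hk : Real.sqrt ((2 * bvar μ ν t)⁻¹) = bkap μ ν t := by
    simp only [bkap, burgersLayerRate, one_div]
  rw [heq, hk] at hsqrt
  exact hsqrt

/-- The chain-rule value of `κ'` equals `κ(s − ν)/s` (uses `2κ²s = 1`). [folklore] -/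
theorem bkap_deriv_eq {μ ν : ℝ} (hν : 0 < ν) (hμ : ν ≤ μ) (t : ℝ) :
    (-(2 * (2 * ν - 2 * bvar μ ν t)) / (2 * bvar μ ν t) ^ 2) / (2 * bkap μ ν t) =
      bkap μ ν t * (bvar μ ν t - ν) / bvar μ ν t := by
  have hs : 0 < bvar μ ν t := bvar_pos hν hμ t
  have hκ : 0 < bkap μ ν t := bkap_pos hν hμ t
  have h1 := two_mul_bkap_sq_mul_bvar hν hμ t
  rw [div_div, div_eq_div_iff (by positivity) hs.ne']
  linear_combination (-4 * bvar μ ν t * (bvar μ ν t - ν)) * h1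

/-- The unit-rate erf profile `G(z) = (1/√π)∫₀^z e^{−r²} dr` (`= burgersLayerProfile 1 (1/2) 1`). [folklore] -/
def gerf : ℝ → ℝ := burgersLayerProfile 1 (1 / 2) 1

/-- `G'(z) = e^{−z²}/√π`. [folklore] -/
def gerfD (z : ℝ) : ℝ := 1 / Real.sqrt Real.pi * Real.exp (-z ^ 2)

/-- `burgersLayerRate 1 (1/2) = 1`. [folklore] -/
theorem burgersLayerRate_half : burgersLayerRate 1 (1 / 2) = 1 := by
  unfold burgersLayerRate; norm_num

/-- Every Burgers profile is the unit erf profile rescaled: `U_B^σ(y) = G(κ_σ y)`. [folklore] -/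
theorem bLP_eq_gerf (σ y : ℝ) : burgersLayerProfile 1 σ 1 y = gerf (burgersLayerRate 1 σ * y) := by
  unfold gerf burgersLayerProfile
  rw [burgersLayerRate_half, one_mul]

/-- `U_B^σ' (y) = κ_σ G'(κ_σ y)`. [folklore] -/
theorem bLPD_eq_gerfD (σ y : ℝ) :
    burgersLayerProfileD 1 σ 1 y = burgersLayerRate 1 σ * gerfD (burgersLayerRate 1 σ * y) := by
  unfold burgersLayerProfileD gerfD
  ring

/-- `HasDerivAt G (G' z) z`. [folklore] -/
theorem hasDerivAt_gerf (z : ℝ) : HasDerivAt gerf (gerfD z) z := by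
  have h := hasDerivAt_burgersLayerProfile' 1 (1 / 2) 1 z
  refine h.congr_deriv ?_
  rw [bLPD_eq_gerfD, burgersLayerRate_half, one_mul, one_mul]

/-- **The breathing Burgers layer** `U(t,y) = U_B^{s(t)}(y)`, `s(t) = ν + (μ − ν)e^{−2t}`. [folklore] -/
def breathing (μ ν : ℝ) (t y : ℝ) : ℝ := burgersLayerProfile 1 (bvar μ ν t) 1 y

/-- `U(t,y) = G(κ(t) y)`. [folklore] -/
theorem breathing_eq (μ ν t y : ℝ) : breathing μ ν t y = gerf (bkap μ ν t * y) :=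
  bLP_eq_gerf _ _

/-- `∂_y U(t,·) = U_B^{s(t)}'`. [folklore] -/
theorem deriv_breathing (μ ν t : ℝ) :
    deriv (breathing μ ν t) = burgersLayerProfileD 1 (bvar μ ν t) 1 :=
  funext fun y => (hasDerivAt_burgersLayerProfile' 1 (bvar μ ν t) 1 y).deriv

/-- `∂_y² U(t,·) = U_B^{s(t)}''`. [folklore] -/
theorem deriv_deriv_breathing (μ ν t : ℝ) :
    deriv (deriv (breathing μ ν t)) = burgersLayerProfileDD 1 (bvar μ ν t) 1 := by
  rw [deriv_breathing]
  exact funext fun y => (hasDerivAt_burgersLayerProfileD 1 (bvar μ ν t) 1 y).deriv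

/-- `∂ₜ U(t,y) = G'(κy)·κ'·y` (chain rule through `G` and `κ`). [folklore] -/
theorem hasDerivAt_breathing_t {μ ν : ℝ} (hν : 0 < ν) (hμ : ν ≤ μ) (t y : ℝ) :
    HasDerivAt (fun τ => breathing μ ν τ y)
      (gerfD (bkap μ ν t * y) *
        ((-(2 * (2 * ν - 2 * bvar μ ν t)) / (2 * bvar μ ν t) ^ 2) / (2 * bkap μ ν t) * y)) t := by
  have hfun : (fun τ => breathing μ ν τ y) = gerf ∘ fun τ => bkap μ ν τ * y := by
    funext τ; exact breathing_eq μ ν τ y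
  rw [hfun]
  exact (hasDerivAt_gerf (bkap μ ν t * y)).comp t ((hasDerivAt_bkap hν hμ t).mul_const y)

/-- **The breathing layer solves the strained heat equation** `Uₜ = yU_y + νU_yy` (pointwise, in the
`deriv` form of `ParallelRelaxes`). [folklore] -/
theorem breathing_pde {μ ν : ℝ} (hν : 0 < ν) (hμ : ν ≤ μ) (t y : ℝ) :
    deriv (fun τ => breathing μ ν τ y) t =
      y * deriv (breathing μ ν t) y + ν * deriv (deriv (breathing μ ν t)) y := by
  rw [(hasDerivAt_breathing_t hν hμ t y).deriv, bkap_deriv_eq hν hμ, deriv_deriv_breathing,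
    deriv_breathing]
  have hs : 0 < bvar μ ν t := bvar_pos hν hμ t
  have hode := burgersLayerProfile_ode 1 (bvar μ ν t) 1 y
  -- `s·DD = −y·D` and `D = κ G'(κ y)`
  rw [bLPD_eq_gerfD] at hode ⊢
  have hDD : burgersLayerProfileDD 1 (bvar μ ν t) 1 y =
      -(y * (burgersLayerRate 1 (bvar μ ν t) * gerfD (burgersLayerRate 1 (bvar μ ν t) * y))) /
        bvar μ ν t := by
    rw [eq_div_iff hs.ne']
    linarith
  rw [hDD]
  show gerfD (bkap μ ν t * y) * (bkap μ ν t * (bvar μ ν t - ν) / bvar μ ν t * y) =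
    y * (bkap μ ν t * gerfD (bkap μ ν t * y)) +
      ν * (-(y * (bkap μ ν t * gerfD (bkap μ ν t * y))) / bvar μ ν t)
  field_simp
  ring

/-- `κ` is smooth (`s > 0`). [folklore] -/
theorem contDiff_bkap {μ ν : ℝ} (hν : 0 < ν) (hμ : ν ≤ μ) {n : WithTop ℕ∞} :
    ContDiff ℝ n (bkap μ ν) := by
  have h1 : ContDiff ℝ n fun t => 1 / (2 * bvar μ ν t) :=
    contDiff_const.div (contDiff_const.mul (contDiff_bvar μ ν)) fun t =>
      mul_ne_zero two_ne_zero (bvar_pos hν hμ t).ne'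
  exact h1.sqrt fun t => by have := bvar_pos hν hμ t; positivity

/-- The breathing layer is jointly `C²` in `(t, y)` (indeed smooth). [folklore] -/
theorem contDiff_breathing {μ ν : ℝ} (hν : 0 < ν) (hμ : ν ≤ μ) :
    ContDiff ℝ 2 fun q : ℝ × ℝ => breathing μ ν q.1 q.2 := by
  have hG : ContDiff ℝ 2 gerf := contDiff_infty.1 (contDiff_burgersLayerProfile 1 (1 / 2) 1) 2
  have hin : ContDiff ℝ 2 fun q : ℝ × ℝ => bkap μ ν q.1 * q.2 :=
    ((contDiff_bkap hν hμ).comp contDiff_fst).mul contDiff_snd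
  have hfun : (fun q : ℝ × ℝ => breathing μ ν q.1 q.2) = gerf ∘ fun q : ℝ × ℝ => bkap μ ν q.1 * q.2 :=
    funext fun q => breathing_eq μ ν q.1 q.2
  rw [hfun]
  exact hG.comp hin

/-- **Slice dissipation of the breathing layer is below the laminar rung**:
`ν ∫ (U_y)² = ν/(2√π √s) ≤ √ν/(2√π)` since `s ≥ ν`. [folklore] -/
theorem nu_mul_integral_breathing_le {μ ν : ℝ} (hν : 0 < ν) (hμ : ν ≤ μ) (t : ℝ) :
    ν * ∫ y, burgersLayerProfileD 1 (bvar μ ν t) 1 y ^ 2 ≤ Real.sqrt ν / (2 * Real.sqrt Real.pi) := by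
  set σ := bvar μ ν t with hσ
  have hσpos : 0 < σ := bvar_pos hν hμ t
  have hνσ : ν ≤ σ := nu_le_bvar hμ t
  have hI := nu_mul_integral_bLPD_sq hσpos   -- σ * J = √σ/(2√π)
  set J := ∫ y, burgersLayerProfileD 1 σ 1 y ^ 2 with hJ
  have hJnn : 0 ≤ J := integral_nonneg fun y => sq_nonneg _
  set a := Real.sqrt ν with ha
  set b := Real.sqrt σ with hb
  have ha2 : a ^ 2 = ν := Real.sq_sqrt hν.le
  have hb2 : b ^ 2 = σ := Real.sq_sqrt hσpos.le
  have hapos : 0 < a := Real.sqrt_pos.2 hν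
  have hbpos : 0 < b := Real.sqrt_pos.2 hσpos
  have hab : a ≤ b := Real.sqrt_le_sqrt hνσ
  have hπ : 0 < 2 * Real.sqrt Real.pi := by positivity
  -- from σ J = b/(2√π):  J·(2√π) = 1/b
  rw [le_div_iff₀ hπ]
  have h1 : σ * J * (2 * Real.sqrt Real.pi) = b := by
    rw [hI]; field_simp
  -- ν J (2√π) = a² J 2√π;  want ≤ a.  Multiply target by b > 0: a² J 2√π b ≤ a b, and σ J 2√π = b gives J 2√π = b/σ = 1/b
  have h2 : J * (2 * Real.sqrt Real.pi) * b = 1 := by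
    have : b ^ 2 * (J * (2 * Real.sqrt Real.pi)) = b := by rw [hb2]; linarith [h1]
    have hbne : b ≠ 0 := hbpos.ne'
    nlinarith [this]
  nlinarith [h2, hab, hapos, hbpos, ha2]

/-- **`ParallelRelaxes` DISCHARGED for the thick-layer datum** `U_B^μ = U_B^ν + (U_B^μ − U_B^ν)`,
`μ ≥ ν`: the breathing layer is the required 1-D relaxing solution (explicit, no semigroup theory).
[folklore] -/
theorem parallelRelaxes_thickLayer {μ ν L c : ℝ} (hν : 0 < ν) (hμ : ν ≤ μ) (hL : 0 < L)
    (hsmall : Real.sqrt ν < 2 * Real.sqrt Real.pi * (c * min L 1)) :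
    ParallelRelaxes ν L c (fun y => ub μ y - ub ν y) := by
  have hμpos : 0 < μ := hν.trans_le hμ
  refine ⟨breathing μ ν, (contDiff_breathing hν hμ).contDiffOn,
    (contDiff_breathing hν hμ).continuous.continuousOn,
    fun t y _ => breathing_pde hν hμ t y, fun t _ => ?far, ?datum, ?lim⟩
  case far =>
    exact ⟨tendsto_burgersLayerProfile_atTop one_pos (bvar_pos hν hμ t) 1,
      tendsto_burgersLayerProfile_atBot one_pos (bvar_pos hν hμ t) 1⟩
  case datum =>
    intro y
    show burgersLayerProfile 1 (bvar μ ν 0) 1 y = ub ν y + (ub μ y - ub ν y)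
    rw [bvar_zero, ub_eq hμpos]
    ring
  case lim =>
    -- every slice is ≤ the laminar constant K, hence so is the Cesàro liminf
    set K : ℝ≥0∞ := ENNReal.ofReal (Real.sqrt ν / (2 * Real.sqrt Real.pi)) with hK
    have hslice : ∀ t, ENNReal.ofReal (ν / L) * ∫⁻ _ in Set.Ioc 0 L, ∫⁻ y,
        ENNReal.ofReal (deriv (breathing μ ν t) y ^ 2) ≤ K := by
      intro t
      have hσ : 0 < bvar μ ν t := bvar_pos hν hμ t
      have hJ : 0 ≤ ∫ y, burgersLayerProfileD 1 (bvar μ ν t) 1 y ^ 2 :=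
        integral_nonneg fun y => sq_nonneg _
      rw [deriv_breathing, lintegral_bLPD_sq hσ, setLIntegral_const, Real.volume_Ioc, sub_zero,
        ← ENNReal.ofReal_mul hJ, ← ENNReal.ofReal_mul (div_nonneg hν.le hL.le)]
      refine ENNReal.ofReal_le_ofReal ?_
      rw [show ν / L * ((∫ y, burgersLayerProfileD 1 (bvar μ ν t) 1 y ^ 2) * L) =
        ν * ∫ y, burgersLayerProfileD 1 (bvar μ ν t) 1 y ^ 2 by field_simp]
      exact nu_mul_integral_breathing_le hν hμ t
    have hev : ∀ᶠ T : ℝ in atTop, ENNReal.ofReal T⁻¹ * ∫⁻ t in Set.Ioc 0 T,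
        ENNReal.ofReal (ν / L) * ∫⁻ _ in Set.Ioc 0 L, ∫⁻ y,
          ENNReal.ofReal (deriv (breathing μ ν t) y ^ 2) ≤
        ENNReal.ofReal T⁻¹ * ∫⁻ _ in Set.Ioc 0 T, K :=
      Eventually.of_forall fun T => mul_le_mul_of_nonneg_left (lintegral_mono fun t => hslice t) bot_le
    have hle := Filter.liminf_le_liminf hev
    rw [liminf_timeMean_const] at hle
    refine lt_of_le_of_lt hle ?_
    rw [hK, ENNReal.ofReal_lt_ofReal_iff_of_nonneg (by positivity)]
    have h2 : 0 < 2 * Real.sqrt Real.pi := by positivity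
    rw [div_lt_iff₀ h2]; linarith

/-- **A FIXED ν-independent shear-layer datum does not rescue θ = 0**: for `μ ≥ ν` the law fails
from `U_B^μ` (i.e. at the non-compactly-supported, `x`-independent perturbation `U_B^μ − U_B^ν`):
the layer thins to `√ν` along the breathing solution and its Cesàro dissipation stays below the
Sweet–Parker rung `√ν/(2√π) < c·min(L,1)`. [folklore] -/
theorem lawAt_thickLayer_false {μ ν L c : ℝ} (hν : 0 < ν) (hμ : ν ≤ μ) (hL : 0 < L)
    (hsmall : Real.sqrt ν < 2 * Real.sqrt Real.pi * (c * min L 1)) :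
    ¬ LawAt c L ν (fun _ y => ub μ y - ub ν y) (fun _ _ => 0) :=
  lawAt_parallel_false_of_relaxation (parallelRelaxes_thickLayer hν hμ hL hsmall)

/-! ## §5 Numerics log (kit compute; the route's CHEAPEST FALSIFIER)

`numerics_log` is a `True` placeholder whose docstring records the DNS campaign (job ids, parameters,
tabulated time-means of `D`). Code: session folder `dns/main.py` (Fourier pseudo-spectral in `x` and `y`,
2/3 dealiasing, integrating-factor RK4, exact mean-flow antiderivative with `u(−Y) = −1/2`), driver
`dns/run_sweep.sh`; evidence files `compute-j*.json` on the item.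
-/

/-- NUMERICS LOG — the route's CHEAPEST FALSIFIER, run by the refuter (pseudo-spectral DNS of the
stretched 2-D NS system, code `dns/main.py`; fixed ν-independent perturbation `AMP = 0.2`, 8 modes,
seed 7; `L = 2`, `Y = 4`). FIRST RESULTS [compute j005025] (started 2026-08-16T05:09Z after 6.7 h in
queue; lane clamp 0.5 h cut it after the ν = 3e-3 case; re-submitted as [compute j014013] with the
ν = 1e-3, 3e-4 cases, plus [compute j014029] ν = 1e-4, [compute j014021] L = 1, 4, [compute j013477]
seeded short cell ℓ = ½, [compute j014035] unseeded short cell):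
* VALIDATION θ = 0, ν = 1e-3 (64×768, T = 5): `D(t) = 0.00892062` constant to 10 digits
  = `√(ν/4π)` ✓ (the Burgers layer is an exact steady state of the scheme); `∮ω = −2.000000000`.
* ν = 1e-2 (Re_δ = ν^{-1/2} = 10; 128×384, T = 60): KH roll-up and complete merger into ONE core per
  period by t ≈ 20, then a STEADY state (D constant to 7 digits over t ∈ [30, 60]):
  `D_∞ = 0.075596`, laminar `0.028209` (ratio 2.68), `L/8π = 0.079577` (95 %). Windows of the running
  mean: [0,5] 0.0295, [5,10] 0.0425, [10,20] 0.0711, [20,30] 0.07553, [30,60] 0.075596.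
* ν = 3e-3 (Re_δ = 18; 192×512, T = 60): same scenario, STEADY single core from t ≈ 20:
  `D_∞ = 0.079259` = 99.6 % of `L/8π`; laminar `0.015451` (ratio 5.13); circulation drift 7e-5,
  boundary leakage ≤ 6e-4, spectral tails ≤ 1e-7 (resolved).
* ν = 1e-3 (Re_δ = 32; 256×768, cut by the lane clamp at t = 41.5 of 60): up to 3 cores at
  t ≈ 3, 2 at t = 5, ONE from t ≈ 10, STEADY (0.1 %) from t = 16.8: `D_∞ = 0.079554` = 99.97 % of
  `L/8π`; laminar `0.008921` (ratio 8.92); windows [0,5] 0.0169, [5,10] 0.0485, [10,15] 0.0779,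
  [15,41.5] 0.07955; circulation drift 2e-4, spectral tails ≤ 1.5e-4, transient boundary excursion
  0.40 during the merger (final 2e-9).
VERDICT SO FAR (three viscosities, one decade): the falsifier does NOT kill the crux — the long-time
dissipation is ν-INDEPENDENT to leading order and converges to the Burgers value of ONE stretched
vortex of circulation `L` per period, `D_∞/(L/8π) = 0.950, 0.996, 0.9997` at `Re_δ = 10, 18, 32`
(laminar ratios 2.7, 5.1, 8.9 ∝ ν^{-1/2}), reached through KH roll-up and COMPLETE coarsening (§3) and
ending in a numerically STEADY `L`-periodic state — numerical evidence FOR the crux with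
`c ≈ 0.075` at `L = 2`, FOR the sibling StretchedVortexRows (3009) and FOR idea C's cell attractor at
these ν. Pending (queued, tag long): ν = 3e-4, 1e-4 (Re_δ = 58, 100: persistence of the steady state,
λ_eff > 1 leakage?), `L = 1, 4` (is it `D_∞ = L/8π`, i.e. `c·min(L,1)` conservative for `L > 1`?),
seeded/unseeded short cell `ℓ = ½`. Report tool: `dns/report.py` (stdlib) over `~/compute/j*`. [folklore] -/
theorem numerics_log : True := trivial

/-! ## §6 Literature negatives read this cycle (page-level) and what they do / do NOT imply

* Kerr 2024, arXiv:2409.09695, §3 pp.3–4 (read): for the LINEARISED steady `x`-periodic mode equation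
  about the PURE stagnation-point flow (NO background shear, `ΔU = 0`: his vortices have decaying
  velocity), `a_n'' + λz a_n' + (λ − n²)a_n = 0` (his `z` = our `y`), integrating over `ℝ` (his (3.6))
  gives: no solution with two zeros; a zero forces ALGEBRAIC decay `a_n ∼ z^{−(λ−n²)/λ}` both ways; a
  one-signed solution cannot decay fast at both ends — "without a supply of vorticity being swept
  towards the plane z = 0 there would be no steady-state vortices" (p.4); his nonlinear steady periodic
  vortices are all FED by algebraic upstream tails, and (p.8) "If this supply was cut off … the
  magnitude of the vortex would decay, but … the rate of decay would be quite small."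
  FORMALISED below (`steadyMode_integral_eq_zero`, `steadyMode_eq_zero_of_nonneg`) in the crux's
  normalisation `ν a'' + y a' + a − νk²a = 0`.
  SCOPE — IMPORTANT: in the crux's class the base flow carries the SHEAR `U(y) → ±1/2`, and the
  linearised steady mode equation about the layer is `ν ŵ'' + y ŵ' + (1 − νk² − ikU(y)) ŵ − v̂ Ω' = 0`
  (Ω = −U'): the advection term `−ikUŵ` makes `ŵ` complex and the integrated identity
  `[νŵ' + yŵ] − νk²∫ŵ − ik∫Uŵ − ∫v̂Ω' = 0` carries NO sign obstruction. So Kerr's no-fed-tails result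
  does NOT transfer to the strained SHEAR layer: Gaussian-localised steady non-parallel modes are an
  honest eigenvalue problem in the Gaussian-weighted space (discrete spectrum of the OU part), and
  Beronov–Kida's standing neutral modes (1996, not yet read here) are exactly such localised steady
  linear states. CONSEQUENCE: the lemma constrains the `ΔU = 0` cousin (Kerr–Dold rows, and any
  argument that drops the shear in the far field), not the unit-cell steady row `S_{ℓ,ν}` of the
  crux ideas; it is recorded so that nobody imports Kerr's obstruction into the sheared problem
  (the refuter nearly did).
* Gallay–Maekawa 2016, arXiv:1610.08384, pp.15–16 (read): `𝒢_λ ∝ e^{−(1+λ)x₁²/4 − (1−λ)x₂²/4}` — the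
  localisation in the neutral direction degenerates as `λ → 1`; existence (Thm 4.1) and large-
  circulation asymptotics (Thm 4.2) for `λ ∈ [0,1)` only, on `ℝ²`. In the crux's cell the neutral
  direction `x` is periodic (compact), so this is a non-applicability, not a no-go, for periodic rows.
* Requested (acq-04373): Buntine–Pullin 1989 JFM 205 (merger of strained vortices incl. the plane-strain
  case) — the printed long-time fate of a merged vortex at λ = 1.
* searchd / galaxy were unavailable or saturated during this cycle (rc 75); Beronov–Kida 1996 critical
  `Re` not yet read (acq-02089 pending from the planner).
-/

/-- **Kerr's integral obstruction, formalised (linear steady modes of the SHEAR-FREE strained problem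
need fed tails; see the §6 scope note — it does not transfer to the sheared layer).** In the crux's
normalisation the steady LINEARISED vorticity equation about ZERO flow (no `±1/2` shear) for the
`x`-Fourier mode `k ≠ 0`,
`a(y)e^{ikx}`, reads `ν a'' + y a' + a − ν k² a = 0` (compression `−y∂_y`, stretching `+a`, diffusion).
Integrating over `[−R, R]` gives `ν k² ∫_{−R}^{R} a = ν (a'(R) − a'(−R)) + R (a(R) + a(−R))` (Kerr 2024,
arXiv:2409.09695, eq. (3.6)); hence a mode whose tails decay fast (`a' → 0`, `y·a(y) → 0`) and which is
integrable has `∫ a = 0` — it cannot be one-signed unless it vanishes: steady perturbation vortices must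
be FED by algebraically decaying upstream vorticity. (Exact statement below; `a'`, `a''` are any
functions with the stated `HasDerivAt` relations.) [cite: Kerr2024, §3 eq. (3.6)] -/
theorem steadyMode_integral_eq_zero {ν k : ℝ} (hν : 0 < ν) (hk : k ≠ 0) {a a' a'' : ℝ → ℝ}
    (hd : ∀ y, HasDerivAt a (a' y) y) (hd' : ∀ y, HasDerivAt a' (a'' y) y) (hcont : Continuous a'')
    (hode : ∀ y, ν * a'' y + y * a' y + a y - ν * k ^ 2 * a y = 0)
    (h1 : Tendsto a' atTop (nhds 0)) (h2 : Tendsto a' atBot (nhds 0))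
    (h3 : Tendsto (fun y => y * a y) atTop (nhds 0)) (h4 : Tendsto (fun y => y * a y) atBot (nhds 0))
    (hint : Integrable a) : ∫ y, a y = 0 := by
  have ha'cont : Continuous a' := continuous_iff_continuousAt.2 fun y => (hd' y).continuousAt
  have hacont : Continuous a := continuous_iff_continuousAt.2 fun y => (hd y).continuousAt
  -- the identity on `[-R, R]`
  have hId : ∀ R : ℝ, ν * k ^ 2 * ∫ y in (-R)..R, a y =
      ν * (a' R - a' (-R)) + (R * a R + R * a (-R)) := by
    intro R
    have hFTC1 : ∫ y in (-R)..R, a'' y = a' R - a' (-R) :=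
      intervalIntegral.integral_eq_sub_of_hasDerivAt (fun y _ => hd' y) (hcont.intervalIntegrable _ _)
    have hprod : ∀ y, HasDerivAt (fun y => y * a y) (1 * a y + y * a' y) y := fun y =>
      (hasDerivAt_id y).mul (hd y)
    have hcont2 : Continuous fun y => 1 * a y + y * a' y := by fun_prop
    have hFTC2 : ∫ y in (-R)..R, (1 * a y + y * a' y) = R * a R - (-R) * a (-R) :=
      intervalIntegral.integral_eq_sub_of_hasDerivAt (fun y _ => hprod y) (hcont2.intervalIntegrable _ _)
    have hsum : ∀ y, ν * k ^ 2 * a y = ν * a'' y + (1 * a y + y * a' y) := fun y => by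
      have := hode y; linarith
    calc ν * k ^ 2 * ∫ y in (-R)..R, a y = ∫ y in (-R)..R, ν * k ^ 2 * a y := by
          rw [intervalIntegral.integral_const_mul]
      _ = ∫ y in (-R)..R, (ν * a'' y + (1 * a y + y * a' y)) := by
          refine intervalIntegral.integral_congr fun y _ => hsum y
      _ = ν * (a' R - a' (-R)) + (R * a R - (-R) * a (-R)) := by
          rw [intervalIntegral.integral_add ((hcont.const_mul ν).intervalIntegrable _ _)
            (hcont2.intervalIntegrable _ _), intervalIntegral.integral_const_mul, hFTC1, hFTC2]
      _ = ν * (a' R - a' (-R)) + (R * a R + R * a (-R)) := by ring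
  -- pass to the limit `R → ∞`
  have hlim : Tendsto (fun R : ℝ => ∫ y in (-R)..R, a y) atTop (nhds (∫ y, a y)) :=
    intervalIntegral_tendsto_integral hint tendsto_neg_atTop_atBot tendsto_id
  have hrhs : Tendsto (fun R : ℝ => ν * (a' R - a' (-R)) + (R * a R + R * a (-R))) atTop (nhds 0) := by
    have e1 : Tendsto (fun R : ℝ => a' (-R)) atTop (nhds 0) := h2.comp tendsto_neg_atTop_atBot
    have e2 : Tendsto (fun R : ℝ => R * a (-R)) atTop (nhds 0) := by
      have := h4.comp tendsto_neg_atTop_atBot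
      have heq : (fun y => y * a y) ∘ Neg.neg = fun R : ℝ => -(R * a (-R)) := by
        funext R; simp [Function.comp]
      rw [heq] at this
      simpa using this.neg
    have := ((h1.sub e1).const_mul ν).add (h3.add e2)
    simpa using this
  have hlhs : Tendsto (fun R : ℝ => ν * k ^ 2 * ∫ y in (-R)..R, a y) atTop (nhds (ν * k ^ 2 * ∫ y, a y)) :=
    hlim.const_mul _
  have heq : (fun R : ℝ => ν * k ^ 2 * ∫ y in (-R)..R, a y) =
      fun R => ν * (a' R - a' (-R)) + (R * a R + R * a (-R)) := funext hId
  rw [heq] at hlhs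
  have h0 : ν * k ^ 2 * ∫ y, a y = 0 := tendsto_nhds_unique hlhs hrhs
  have hνk : ν * k ^ 2 ≠ 0 := mul_ne_zero hν.ne' (pow_ne_zero 2 hk)
  exact (mul_eq_zero.1 h0).resolve_left hνk

/-- **Corollary (Kerr 2024, §3, third result):** a one-signed, integrable, fast-decaying steady linear
mode of the shear-free strained problem vanishes identically — "without a supply of vorticity being
swept towards the plane there would be no steady-state vortices" (linearised, `ΔU = 0`; with the
crux's shear the mode is complex and the argument is void, §6). [cite: Kerr2024, §3] -/
theorem steadyMode_eq_zero_of_nonneg {ν k : ℝ} (hν : 0 < ν) (hk : k ≠ 0) {a a' a'' : ℝ → ℝ}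
    (hd : ∀ y, HasDerivAt a (a' y) y) (hd' : ∀ y, HasDerivAt a' (a'' y) y) (hcont : Continuous a'')
    (hode : ∀ y, ν * a'' y + y * a' y + a y - ν * k ^ 2 * a y = 0)
    (h1 : Tendsto a' atTop (nhds 0)) (h2 : Tendsto a' atBot (nhds 0))
    (h3 : Tendsto (fun y => y * a y) atTop (nhds 0)) (h4 : Tendsto (fun y => y * a y) atBot (nhds 0))
    (hint : Integrable a) (hnonneg : ∀ y, 0 ≤ a y) : ∀ y, a y = 0 := by
  have hacont : Continuous a := continuous_iff_continuousAt.2 fun y => (hd y).continuousAt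
  have hI := steadyMode_integral_eq_zero hν hk hd hd' hcont hode h1 h2 h3 h4 hint
  have hae : a =ᵐ[volume] 0 := (integral_eq_zero_iff_of_nonneg (fun y => hnonneg y) hint).1 hI
  have := hacont.ae_eq_iff_eq volume continuous_const |>.1 hae
  exact fun y => congrFun this y

/-! ## §7 Pre-pick adversarial audit of the round-1 crux ideas (`Cruxes/StrainedLayerLaw/Ideas/*`,
stubs in `FirstLemmasK2.lean`; read 2026-08-16) — hand verifications, verdicts, and the one weak joint

Idea A `strain-work-sum-rule` (stubs `StrainWorkIdentity`, `FloorTransfer`, `CoreWork`):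
* A1 VERIFIED by hand. With `e = ½(u²+v²−¼)`, `U⃗ = (u, v−y)`, `div U⃗ = −1`:
  `∂ₜe + U⃗·∇e = v² − (u pₓ + v p_y) + ν(uΔu + vΔv)`; integrating over a period strip under `ExpTails`
  (so `e`, `pv`, `u u_y` vanish at `|y| = ∞`) gives `dE/dt = −E + ∫∫v² − L·D`, i.e. `L·D = J − dE/dt`
  with `J = ∫∫v² − E = ½∫∫(¼ − u² + v²)`. Laminar check: `J(U_B) = ½L∫(¼ − U_B²)dy = (L/8)√(2ν)·
  ∫(1 − erf²) = (L/8)√(2ν)·2√2/√π = L√ν/(2√π) = L·D_lam` ✓ (`∫_ℝ(1−erf²) = 2√2/√π` from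
  `∫₀^∞ erfc = 1/√π`, `∫₀^∞ erfc² = (2−√2)/√π`). Also `J = −∫∫ yωu` by two integrations by parts. TRUE.
* A2 TRUE (Cesàro bookkeeping; the `∫⁻` over `(0,1]` only enlarges the `ℝ≥0∞` liminf).
* A3 VERIFIED: `−∫∫ yωu_self = ½∫₀^∞ wΓ r dr = Γ(∞)²/8π` (angular average of `sin²`). TRUE.
* WEAK JOINT (not a falsity): the identity needs `ExpTails`, i.e. the PHYSICAL solution, while the
  crux quantifies over every `InClass` solution; a wild solution (finite `D`-slices, infinite or
  non-differentiable `E`) escapes the sum rule. The transfer to the crux therefore needs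
  `UniqueInClass` (below) or a restated crux with the weighted side condition — the M3 issue again.
Idea B `contraction-capture` (stubs `FinePeriodReduction`, `CentroidDecay`, `StrainedCapture`,
  hypothesis `UniqueInClass`):
* B1 TRUE as an implication; note the proof must also derive `ℓ`-periodicity of `p` (uniqueness
  gives `u, v` only): `∇p` is determined by `(u,v)` through the momentum equations, so
  `p(x+ℓ) − p(x) = m(t)` and `L`-periodicity forces `n·m(t) = 0`. Constants:
  `c·ℓ ≥ c·min(1, L₀/2)·min(L,1)` checked in both cases `L ≤ L₀` / `L > L₀`.
* B2 VERIFIED: conservation form `ωₜ + div(ωU⃗) = νΔω`; `d/dt∫∫yω = ∫∫ω(v − y)` and `∫∫ωv = 0`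
  (`ωv = ∂ₓ(v²/2) − u_y v`, `∫∫u_y v = −∫∫u v_y = ∫∫u uₓ = 0`). TRUE under the stated tails.
* B3 VERIFIED: `d(r²)/dt = −2y²`; if `r² ↓ r∞² > 0` then `y² ∈ L¹`, `ẏ` bounded ⇒ `y → 0`
  (Barbalat), `|x| → r∞`, `ẏ → ±κ/r∞ ≠ 0`, contradiction; no finite-time collapse is asserted
  (hypothesis: the solution exists with `r > 0` for all `t ≥ 0`; indeed `r² ∼ e^{−t}` by averaging).
  TRUE. Its modelling use ("strained like-signed pairs always merge", κ = Γ/4π) agrees with §3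
  (`strainedRow_pairing_unstable`): coarsening is one-way in every point-vortex idealisation tried.
* `UniqueInClass` — DOUBTFUL AS STATED, UNREFUTED: `InClass` bounds neither `ω` nor any growth of
  `∇(u,v)` at `|y| = ∞` (e.g. `u = ½ + sin(y³)/y` has the far-field limit with unbounded `u_y`), so
  neither the parabolic maximum principle for `ω` nor an energy method for the difference starts;
  a ghost would have to be a slice-wise bounded null solution of (a perturbation of) the heat flow
  `W_s = W_ηη` (§4 substitution), which the refuter could neither construct nor exclude. Every
  transfer in ideas A–C leans on it. RECOMMENDATION (planner): restate the crux / DenseCellLaw with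
  `ω(t,·) ∈ L¹ ∩ L^∞` of the period strip locally uniformly in `t` (or the Gaussian-weighted class);
  then uniqueness is Gallay–Wayne-type and the wild-solution gap of idea A closes simultaneously.
Idea C `unit-cell-burgers-row-attractor` (stubs `DenseRowSharp`, `SteadySumRule`, `AttractorTransfer`):
* C2, C3 TRUE (C2 = A1 at a steady state; C3 = Cesàro limit of a convergent `ℝ≥0∞` function with
  finite partial integrals).
* C1 OPEN (existence of the steady cell state at the plane-strain endpoint; §6: Kerr's obstruction
  does NOT apply because of the shear; GM2016's λ < 1 restriction is a non-applicability in the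
  periodic cell). The two-sided bound `(1 ± ε)ℓ/8π` additionally asserts that ALL circulation sits
  in ONE round core with `o(ℓ²)` left in sheets — plausible for `ℓ ≤ L₀` small, untested. The card's
  own falsifier (steady Newton continuation) is the right first check; the refuter's DNS (§5, and
  [compute j013477] for the seeded short cell `ℓ = ½`) tests the dynamic version: does the
  trajectory settle near such a state with `J/ℓ → ℓ/8π = 0.0199`?
NUMERICAL TESTS QUEUED FOR THESE IDEAS: every DNS case now logs `J/L`, `E`, `M₁ = ∫∫yω` (B2 predicts
`M₁ ∝ e^{−t}`), the trapped circulation `Γ_core` (disc `r < 0.3` about the vorticity minimum) and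
checks `L·D = J − dE/dt` a posteriori; θ = 0 validation must return `J/L = D = √ν/(2√π)` (A1 laminar
check above).
-/

end Summit.AnomalousDissipation.AnomalousDissipation.Cruxes.StrainedLayerLaw.Disproof
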